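/-
Copyright (c) 2026 the pub-hodgecm-mathlib formalisation cell (harness21).  Prover seat hodgecm-mathlib-K2Liu-p11 (g2), Track B «K2-LIT»,
#184♮ = hLiu418 = `stmt-HodgeConjecture-24832`; A7-val road (σ), file V6b (LEAD F0P6-plan (g14) BATCH #9 (3) ∕ #10 (1): «V6b = K2Liu-p11 FIRST:
instantiate ★ V6a at `ℓ := B` and export exactly K2Liu-p09's five letters `Bbar`, `cK ≠ 0`, `hBbar_fix`, `hBbar_G`, `hBbar_law`»).
THEOREMS ONLY (no `def`, no `instance`, no notation, no named-fact hypothesis, no `sorry`).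
-/
import Summits.HodgeConjecture.HodgeConjecture.Theorems.K2LiuIkedaFunctionalAverage            -- ★ V6a (this seat): the generic `K′`-average
import Literature.RepresentationTheory.HeisenbergGroup.SchrodingerSymplecticGenerators          -- ★ `leviEquivSB`, `coe_leviEquivSB`, `leviOp_mul`
import HarnessLib

/-!
# Crux `HLiu418`, A7-val (σ), V6b: THE `K′`-AVERAGE EXPORTS — the five binders `Bbar`, `cK ≠ 0`, `hBbar_fix`, `hBbar_G`, `hBbar_law`
# of ★ V8c `K2LiuA7Value.value_eq_const_mul_of_laws`, DISCHARGED from ★ V6a for the Levi action `leviEquivSB ∘ ρ` on `𝒮(X)`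

Cell `hodgecm-mathlib`, crux item hLiu418 = `stmt-HodgeConjecture-24832` (helper lane `--supports`, count-neutral).

SETTING (= ★ V8c's binders (M3)): `X` a topological `R`-module (`X = F_v^{ιX}` there), `V := SchwartzBruhat X`, a section-valued functional
`B : 𝒮(X) →ₗ[ℂ] (H → ℂ)`, a group `G` (= `U(V′_v)`) acting on `X` through `ρ : G →* (X ≃ₗ[R] X)` with `ρ g`, `(ρ g)⁻¹` continuous, hence on `𝒮(X)` by
`leviEquivSB (ρ g)`; a compact open subgroup `K′ ≤ G` with a Haar measure `μK`; for the `G`-invariance: a closed subgroup `P ≤ G` with `G = P·K′`,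
`G` unimodular second countable, and `B` `(P, Δ_P)`-EQUIVARIANT with continuous coefficients (the instance pins — Witt transitivity, ★ A2a∕A2c,
★ `norm_rootDeltaChar_sq_mul_modularCharacter_inv` — are V8-inst's, BY VALUE here).
* §1 `leviEquivSB_rho_mul` ∕ `leviEquivSB_rho_one` — `g ↦ leviEquivSB (ρ g)` is multiplicative (★ `leviOp_mul`), so it packages as a representation
  `ω : G →* End_ℂ 𝒮(X)` inside the proofs (`exists_hom_leviEquivSB`);
* §2 **`exists_kPrimeAverage_exports`** — THE FIVE LETTERS AT ONCE: `∃ Bbar cK, cK ≠ 0 ∧ hBbar_fix ∧ hBbar_G ∧ hBbar_law`, with the explicit formula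
  `Bbar Φ h = ∫ k : ↥K′, B (leviEquivSB (ρ k) Φ) h ∂μK` and `cK = μK(K′)` as extra conjuncts (★ V6a `exists_linearMap_average`, `average_eq_of_forall_fixed`,
  `measureReal_univ_pos`, `average_mul_eq_average`, `average_law`);
* §3 `exists_kPrimeAverage_exports_of_invariant` — the same WITHOUT the Iwasawa∕measure-on-`G` data when `B` is already `ρ(G)`-invariant
  (`Bbar := μK(K′) • B`).
References: [Bump1997, Prop. 2.1.5, §2.6]; [GanQiuTakeda2014, §2.7–2.8]; [MoeglinVignerasWaldspurger1987, Chap. 2 II.6].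
HONEST LABEL: HC_CM is proved only modulo the 7 printed citations (2 remaining named inputs: hLiu418 = stmt-HodgeConjecture-24832,
h413 = stmt-HodgeConjecture-24833) until rung 0 closes; count-neutral helper, closes no socket.
-/

set_option autoImplicit false
set_option linter.dupNamespace false

noncomputable section

open MeasureTheory MeasureTheory.Measure Set Filter Topology
open scoped NNReal ENNReal

namespace Summit.HodgeConjecture.HodgeConjecture.Cruxes.HLiu418.K2LiuA7ValueKPrimeAverageExports

open Literature.NumberTheory.Automorphic Literature.RepresentationTheory.HeisenbergGroup
open Summit.HodgeConjecture.HodgeConjecture.Cruxes.HLiu418.K2LiuIkedaFunctionalAverage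

universe u

variable {R : Type*} [CommRing R] {X : Type*} [AddCommGroup X] [Module R X] [TopologicalSpace X]
variable {G : Type u} [Group G]

/-! ## §1  `g ↦ leviEquivSB (ρ g)` is a representation -/

/-- `leviEquivSB (ρ (g g′)) = leviEquivSB (ρ g) ∘ leviEquivSB (ρ g′)` (★ `leviOp_mul`). [MoeglinVignerasWaldspurger1987, Chap. 2 II.6] -/
theorem leviEquivSB_rho_mul (ρ : G →* (X ≃ₗ[R] X)) (hρc : ∀ g, Continuous (ρ g)) (hρc' : ∀ g, Continuous (ρ g).symm) (g g' : G)
    (Φ : SchwartzBruhat X) :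
    leviEquivSB (ρ (g * g')) (hρc (g * g')) (hρc' (g * g')) Φ = leviEquivSB (ρ g) (hρc g) (hρc' g) (leviEquivSB (ρ g') (hρc g') (hρc' g') Φ) := by
  apply Subtype.ext
  rw [coe_leviEquivSB, coe_leviEquivSB, coe_leviEquivSB, map_mul, leviOp_mul]
  rfl

/-- `leviEquivSB (ρ 1) = id`. [MoeglinVignerasWaldspurger1987, Chap. 2 II.6] -/
theorem leviEquivSB_rho_one (ρ : G →* (X ≃ₗ[R] X)) (hρc : ∀ g, Continuous (ρ g)) (hρc' : ∀ g, Continuous (ρ g).symm) (Φ : SchwartzBruhat X) :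
    leviEquivSB (ρ 1) (hρc 1) (hρc' 1) Φ = Φ := by
  apply Subtype.ext
  rw [coe_leviEquivSB, map_one, leviOp_one]
  rfl

/-- The representation `ω : G →* End_ℂ 𝒮(X)` with `ω g = leviEquivSB (ρ g)` EXISTS (packaged; no definition is introduced).
[MoeglinVignerasWaldspurger1987, Chap. 2 II.6] -/
theorem exists_hom_leviEquivSB (ρ : G →* (X ≃ₗ[R] X)) (hρc : ∀ g, Continuous (ρ g)) (hρc' : ∀ g, Continuous (ρ g).symm) :
    ∃ ω : G →* (SchwartzBruhat X →ₗ[ℂ] SchwartzBruhat X), ∀ g Φ, ω g Φ = leviEquivSB (ρ g) (hρc g) (hρc' g) Φ := by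
  refine ⟨{ toFun := fun g => (leviEquivSB (ρ g) (hρc g) (hρc' g)).toLinearMap, map_one' := ?_, map_mul' := fun g g' => ?_ }, fun g Φ => rfl⟩
  · ext Φ : 1
    exact leviEquivSB_rho_one ρ hρc hρc' Φ
  · ext Φ : 1
    exact leviEquivSB_rho_mul ρ hρc hρc' g g' Φ

/-! ## §2  The five exports -/

variable [TopologicalSpace G] [IsTopologicalGroup G] [LocallyCompactSpace G] [T2Space G] [SecondCountableTopology G]
  [MeasurableSpace G] [BorelSpace G] {P K' : Subgroup G} [LocallyCompactSpace ↥P] {H : Type*}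

/-- **V6b — THE FIVE EXPORTS `Bbar`, `cK ≠ 0`, `hBbar_fix`, `hBbar_G`, `hBbar_law` OF ★ V8c, AT ONCE.**  Given the `(P, Δ_P)`-equivariance of `B` under
the Levi action, continuity of its coefficients, `G = P·K′` with `G` unimodular and `K′` compact open: there are a LINEAR `Bbar : 𝒮(X) →ₗ[ℂ] (H → ℂ)` and
`cK ≠ 0` (`= μK(K′)`) with (fix) `Bbar Φ = cK · B Φ` on `leviOp(ρ K′)`-invariant `Φ`, (G) `Bbar ∘ leviEquivSB (ρ g) = Bbar`, (law) every law
`B (A Ψ) h = a · B Ψ h′` of an operator `A` commuting with `leviEquivSB (ρ K′)` passes to `Bbar`, and the formula `Bbar Φ h = ∫_{K′} B (leviEquivSB (ρ k) Φ) h dμK`.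
[Bump1997, Prop. 2.1.5] [GanQiuTakeda2014, §2.7–2.8] -/
theorem exists_kPrimeAverage_exports (ρ : G →* (X ≃ₗ[R] X)) (hρc : ∀ g, Continuous (ρ g)) (hρc' : ∀ g, Continuous (ρ g).symm)
    (B : SchwartzBruhat X →ₗ[ℂ] (H → ℂ))
    (hP : IsClosed (P : Set G)) (hK' : IsCompact (K' : Set G) ∧ IsOpen (K' : Set G)) (hPK : ∀ g : G, ∃ p ∈ P, ∃ k ∈ K', g = p * k)
    (μG : Measure G) [IsHaarMeasure μG] [μG.IsMulRightInvariant] (μP : Measure ↥P) [IsHaarMeasure μP] (μK : Measure ↥K') [IsHaarMeasure μK]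
    (hBP : ∀ (p : ↥P) (Φ : SchwartzBruhat X) (h : H),
      B (leviEquivSB (ρ (p : G)) (hρc (p : G)) (hρc' (p : G)) Φ) h = (((modularCharacter p : ℝ≥0) : ℝ) : ℂ) * B Φ h)
    (hcont : ∀ (Φ : SchwartzBruhat X) (h : H), Continuous fun g : G => B (leviEquivSB (ρ g) (hρc g) (hρc' g) Φ) h) :
    ∃ (Bbar : SchwartzBruhat X →ₗ[ℂ] (H → ℂ)) (cK : ℂ), cK ≠ 0 ∧
      (∀ Φ : SchwartzBruhat X, (∀ k ∈ K', leviOp (ρ k) (Φ : X → ℂ) = Φ) → ∀ h, Bbar Φ h = cK * B Φ h) ∧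
      (∀ (g : G) (Φ : SchwartzBruhat X) (h : H), Bbar (leviEquivSB (ρ g) (hρc g) (hρc' g) Φ) h = Bbar Φ h) ∧
      (∀ A : SchwartzBruhat X →ₗ[ℂ] SchwartzBruhat X,
        (∀ k ∈ K', ∀ Φ, A (leviEquivSB (ρ k) (hρc k) (hρc' k) Φ) = leviEquivSB (ρ k) (hρc k) (hρc' k) (A Φ)) →
        ∀ (h h' : H) (a : ℂ), (∀ Ψ, B (A Ψ) h = a * B Ψ h') → ∀ Φ, Bbar (A Φ) h = a * Bbar Φ h') ∧
      (∀ (Φ : SchwartzBruhat X) (h : H), Bbar Φ h = ∫ k : ↥K', B (leviEquivSB (ρ (k : G)) (hρc (k : G)) (hρc' (k : G)) Φ) h ∂μK) ∧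
      cK = (μK.real univ : ℂ) := by
  obtain ⟨ω, hω⟩ := exists_hom_leviEquivSB ρ hρc hρc'
  -- integrability of the coefficients on `K′` (smooth vectors)
  have hint : ∀ (Φ : SchwartzBruhat X) (h : H), Integrable (fun k : ↥K' => B (ω (k : G) Φ) h) μK := fun Φ h => by
    have hc : Continuous fun g : G => B (ω g Φ) h := by
      simp only [hω]
      exact hcont Φ h
    exact integrable_coeff_of_continuous hK'.1 μK ω B Φ h hc
  obtain ⟨Bbar, hBbar⟩ := exists_linearMap_average μK ω B hint
  refine ⟨Bbar, (μK.real univ : ℂ), ?_, ?_, ?_, ?_, ?_, rfl⟩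
  · exact_mod_cast (measureReal_univ_pos hK'.1 μK).ne'
  · -- (fix)
    intro Φ hΦ h
    have hfix : ∀ k : ↥K', ω (k : G) Φ = Φ := fun k => by
      rw [hω]
      apply Subtype.ext
      rw [coe_leviEquivSB]
      exact hΦ k k.2
    rw [hBbar, average_eq_of_forall_fixed μK ω B hfix h]
  · -- (G)
    intro g Φ h
    have hBω : ∀ (p : ↥P) (Ψ : SchwartzBruhat X), B (ω (p : G) Ψ) h = (((modularCharacter p : ℝ≥0) : ℝ) : ℂ) * B Ψ h := fun p Ψ => by
      rw [hω]
      exact hBP p Ψ h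
    have hc : Continuous fun x : G => B (ω x Φ) h := by
      simp only [hω]
      exact hcont Φ h
    rw [hBbar, hBbar, ← hω g Φ]
    exact average_mul_eq_average hP hK'.1 hK'.2 hPK μG μP μK ω B h hBω Φ hc g
  · -- (law)
    intro A hA h h' a hlaw Φ
    have hAω : ∀ (k : ↥K') (Ψ : SchwartzBruhat X), A (ω (k : G) Ψ) = ω (k : G) (A Ψ) := fun k Ψ => by
      rw [hω, hω]
      exact hA k k.2 Ψ
    rw [hBbar, hBbar]
    exact average_law μK ω B A hAω hlaw Φ
  · intro Φ h
    rw [hBbar]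
    simp only [hω]

/-! ## §3  The exports when `B` is already `ρ(G)`-invariant (no Iwasawa data) -/

omit [IsTopologicalGroup G] [LocallyCompactSpace G] [T2Space G] [SecondCountableTopology G] [BorelSpace G] [LocallyCompactSpace ↥P] in
/-- **THE FIVE EXPORTS FOR A `ρ(G)`-INVARIANT `B`** (`B (leviEquivSB (ρ g) Φ) = B Φ` for all `g`): then the average is `μK(K′) · B Φ` for EVERY `Φ`, so
`Bbar := μK(K′) • B` satisfies all five letters (no Iwasawa ∕ measure-on-`G` data needed). [GanQiuTakeda2014, §2.8] -/
theorem exists_kPrimeAverage_exports_of_invariant (ρ : G →* (X ≃ₗ[R] X)) (hρc : ∀ g, Continuous (ρ g)) (hρc' : ∀ g, Continuous (ρ g).symm)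
    (B : SchwartzBruhat X →ₗ[ℂ] (H → ℂ)) (hK' : IsCompact (K' : Set G) ∧ IsOpen (K' : Set G)) (μK : Measure ↥K') [IsHaarMeasure μK]
    (hBG : ∀ (g : G) (Φ : SchwartzBruhat X) (h : H), B (leviEquivSB (ρ g) (hρc g) (hρc' g) Φ) h = B Φ h) :
    ∃ (Bbar : SchwartzBruhat X →ₗ[ℂ] (H → ℂ)) (cK : ℂ), cK ≠ 0 ∧
      (∀ Φ : SchwartzBruhat X, (∀ k ∈ K', leviOp (ρ k) (Φ : X → ℂ) = Φ) → ∀ h, Bbar Φ h = cK * B Φ h) ∧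
      (∀ (g : G) (Φ : SchwartzBruhat X) (h : H), Bbar (leviEquivSB (ρ g) (hρc g) (hρc' g) Φ) h = Bbar Φ h) ∧
      (∀ A : SchwartzBruhat X →ₗ[ℂ] SchwartzBruhat X,
        (∀ k ∈ K', ∀ Φ, A (leviEquivSB (ρ k) (hρc k) (hρc' k) Φ) = leviEquivSB (ρ k) (hρc k) (hρc' k) (A Φ)) →
        ∀ (h h' : H) (a : ℂ), (∀ Ψ, B (A Ψ) h = a * B Ψ h') → ∀ Φ, Bbar (A Φ) h = a * Bbar Φ h') ∧
      (∀ (Φ : SchwartzBruhat X) (h : H), Bbar Φ h = ∫ k : ↥K', B (leviEquivSB (ρ (k : G)) (hρc (k : G)) (hρc' (k : G)) Φ) h ∂μK) := by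
  have hpos : (μK.real univ : ℂ) ≠ 0 := by exact_mod_cast (measureReal_univ_pos hK'.1 μK).ne'
  refine ⟨(μK.real univ : ℂ) • B, (μK.real univ : ℂ), hpos, fun Φ _ h => rfl, fun g Φ h => ?_, fun A _ h h' a hlaw Φ => ?_, fun Φ h => ?_⟩
  · simp only [LinearMap.smul_apply, Pi.smul_apply, smul_eq_mul, hBG]
  · simp only [LinearMap.smul_apply, Pi.smul_apply, smul_eq_mul, hlaw Φ]
    ring
  · simp only [LinearMap.smul_apply, Pi.smul_apply, smul_eq_mul, hBG, integral_const, Complex.real_smul]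

end Summit.HodgeConjecture.HodgeConjecture.Cruxes.HLiu418.K2LiuA7ValueKPrimeAverageExports

end
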